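import Summits.PneNP.PneNP.Theorems.PhaseTwinsPolyDepthTwinsAboveAcDefs
import Summits.PneNP.PneNP.Theorems.PhaseTwinsPolyDepthTwinsAboveParameters
import Literature.Computability.Complexity.ApproximateMajorityEstimates

/-!
# Crux `PolyDepthTwinsAbove` (stmt-PneNP-2719), line `annealed-cover-twins`: stub `stub_parameters`

Route `PhaseTwins`, thesis `PolyDepthTwinsAbove`, line `annealed-cover-twins`, stub S7
(`stub_parameters`).

The parameter regime of the line `annealed-cover-twins` is nonempty (pure asymptotic bookkeeping,
no cited fact). Given the port-law exponent `θ₀ > 0`, the expansion `η > 0` and the two complex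
factors `0 < F₁ < F₀`, put `k := ⌈2/θ₀⌉₊ + 1` (so `k θ₀ ≥ 2`), `θ' := 1/(2(k+1))`, and for a
threshold variable `m₀`: `M = 2(D+1) m₀`, `n' = 2 M^k`, `κ = ⌈log (4M) / log (F₀/F₁)⌉₊`,
`K = ⌊η M/7⌋₊`. Writing `L := log (F₀/F₁) > 0`, each of the eleven conjuncts consumed by the
composition `PolyDepthTwinsAbove_of` reduces to a threshold `M ≥ C`:
* `N₀, n₀ ≤ M ≤ n'`, `2 ≤ M`;
* `κ ≤ log (4M)/L + 1 ≤ M/2` once `log M ≤ (L/4) M` and `log 4 + L ≤ (L/4) M` (`log = o(id)`),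
  whence `κ ≤ M ≤ M^k` and `2κ ≤ M ≤ M² ≤ M^{kθ₀} ≤ n'^{θ₀}`;
* `(F₀^κ + F₁^κ)^M ≤ 2 (F₀^κ - F₁^κ)^M`: `κ L ≥ log (4M)` gives `(F₀/F₁)^κ ≥ 4M`, so
  `r := F₁^κ/F₀^κ` has `M r ≤ 1/4`, and
  `(1+r)^M ≤ exp (M r) ≤ e^{1/4} ≤ 4/3 ≤ 2 (1 - M r) ≤ 2 (1-r)^M` (Bernoulli);
* `2 (1+ε)^{3M} ≤ 3 (1-ε)^{3M}` for `ε = n'^{-θ₀} ≤ 1/M²`: `3Mε ≤ 3/M ≤ 1/8` for `M ≥ 24`, and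
  `2 (1+ε)^{3M} ≤ 2/(1 - 1/8) = 16/7 < 21/8 ≤ 3 (1 - 3Mε) ≤ 3 (1-ε)^{3M}`; `ε ≤ 1` as `n' ≥ 1`;
* `6K ≤ 6ηM/7 < ηM`, `K ≥ 1` once `η M ≥ 14`;
* `(6Mn' + 10Mκ)^{θ'} ≤ K`: `6Mn' + 10Mκ = 12 M^{k+1} + 10 M κ ≤ 22 M^{k+1} ≤ (22M)^{k+1}`, which is
  `≤ (K²)^{k+1}` once `K² ≥ 22 M` (`K ≥ ηM/14`, `η² M ≥ 4312`).
The finitely many thresholds are collected with `Filter.eventually_atTop`, using the sibling line's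
helpers `eventually_le_const_mul_natCast`, `eventually_log_le_mul_natCast`; Bernoulli's inequality
`1 - k t ≤ (1 - t)^k` is the tree lemma `one_sub_mul_le_one_sub_pow`.
-/

noncomputable section

open scoped Classical BigOperators

namespace Summit.PneNP.PneNP.Cruxes.PolyDepthTwinsAbove.AnnealedCoverTwins

open Summit.PneNP.PneNP.Cruxes.PolyDepthTwinsAbove.ParityWiredPorts (eventually_le_const_mul_natCast
  eventually_log_le_mul_natCast)
open Literature.Computability.Complexity (one_sub_mul_le_one_sub_pow)

set_option linter.dupNamespace false

variable {M n' κ dm : ℕ}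

/-- `(1 + r)^n ≤ 1/(1 - t)` whenever `0 ≤ r` and `n r ≤ t < 1`:
`(1 + r)^n ≤ exp (n r) ≤ exp t ≤ 1/(1 - t)`. -/
theorem acParam_one_add_pow_le_of_mul_le {r t : ℝ} (hr : 0 ≤ r) {n : ℕ} (ht : (n : ℝ) * r ≤ t)
    (ht1 : t < 1) : (1 + r) ^ n ≤ 1 / (1 - t) := by
  have h0 : 0 ≤ t := le_trans (by positivity) ht
  calc (1 + r) ^ n ≤ Real.exp r ^ n :=
        pow_le_pow_left₀ (by positivity) (by linarith [Real.add_one_le_exp r]) n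
    _ = Real.exp (n * r) := (Real.exp_nat_mul r n).symm
    _ ≤ Real.exp t := Real.exp_le_exp.2 ht
    _ ≤ 1 / (1 - t) := Real.exp_bound_div_one_sub_of_interval h0 ht1

set_option maxHeartbeats 400000 in
/-- **The parameter regime of the line is nonempty (S7).** Given the port-law exponent `θ₀ > 0`, the
expansion `η > 0` and the two complex factors `0 < F₁ < F₀`: with `k = ⌈2/θ₀⌉₊ + 1` (`k θ₀ ≥ 2`),
`θ' = 1/(2k+2)`, `M = m₀·2(D+1)`, `n' = 2M^k`, `κ = ⌈log(4M)/log(F₀/F₁)⌉₊`, `K = ⌊ηM/7⌋₊`, for all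
`m₀` beyond a threshold: `N₀ ≤ M`, `n₀ ≤ n'`, `κ ≤ M^k`, `2κ ≤ n'^{θ₀}`,
`(F₀^κ+F₁^κ)^M ≤ 2(F₀^κ-F₁^κ)^M`, `2(1+ε)^{3M} ≤ 3(1-ε)^{3M}` and `ε ≤ 1` for `ε = n'^{-θ₀}`,
`6K < ηM`, `2 ≤ M`, `1 ≤ K`, and `(6Mn' + 10Mκ)^{θ'} ≤ K`. -/
theorem stub_parameters {θ₀ η F0 F1 : ℝ} (hθ₀ : 0 < θ₀) (hη : 0 < η) (hF1 : 0 < F1) (hF : F1 < F0)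
    (D n₀ : ℕ) :
    ∃ θ' : ℝ, 0 < θ' ∧ ∃ k : ℕ, 1 ≤ k ∧ ∀ N₀ : ℕ, ∃ m₁ : ℕ, ∀ m₀ : ℕ, m₁ ≤ m₀ →
      ∀ M n' κ K : ℕ, M = m₀ * 2 * (D + 1) → n' = 2 * M ^ k →
        κ = ⌈Real.log (4 * (M : ℝ)) / Real.log (F0 / F1)⌉₊ → K = ⌊η * M / 7⌋₊ →
          N₀ ≤ M ∧ n₀ ≤ n' ∧ κ ≤ M ^ k ∧
          (2 * κ : ℝ) ≤ (n' : ℝ) ^ θ₀ ∧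
          (F0 ^ κ + F1 ^ κ) ^ M ≤ 2 * (F0 ^ κ - F1 ^ κ) ^ M ∧
          2 * (1 + (n' : ℝ) ^ (-θ₀)) ^ (3 * M) ≤ 3 * (1 - (n' : ℝ) ^ (-θ₀)) ^ (3 * M) ∧
          (n' : ℝ) ^ (-θ₀) ≤ 1 ∧
          (2 * 3 * K : ℝ) < η * M ∧ 2 ≤ M ∧ 1 ≤ K ∧
          (((6 * M * n' + 10 * M * κ : ℕ) : ℝ)) ^ θ' ≤ K := by
  -- the exponent `k = ⌈2/θ₀⌉₊ + 1`: `k θ₀ ≥ 2`, `k ≥ 1`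
  obtain ⟨k, hk⟩ : ∃ k : ℕ, k = ⌈2 / θ₀⌉₊ + 1 := ⟨_, rfl⟩
  have hkge : 2 / θ₀ ≤ (k : ℝ) := by
    rw [hk]; push_cast; linarith [Nat.le_ceil (2 / θ₀)]
  have hk2 : 2 ≤ (k : ℝ) * θ₀ := (div_le_iff₀ hθ₀).1 hkge
  have hk1 : 1 ≤ k := by omega
  have hk0 : k ≠ 0 := by omega
  have hF0 : 0 < F0 := hF1.trans hF
  -- `L = log (F₀/F₁) > 0`
  have hL : 0 < Real.log (F0 / F1) := Real.log_pos ((one_lt_div hF1).2 hF)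
  set L := Real.log (F0 / F1) with hLdef
  refine ⟨1 / (2 * ((k : ℝ) + 1)), by positivity, k, hk1, fun N₀ => ?_⟩
  -- the finitely many thresholds on `M`
  have hL4 : 0 < L / 4 := by positivity
  obtain ⟨M₁, hM₁⟩ := Filter.eventually_atTop.1 ((Filter.eventually_ge_atTop 24).and
    ((eventually_log_le_mul_natCast hL4).and
    ((eventually_le_const_mul_natCast hL4 (Real.log 4 + L)).and
    ((eventually_le_const_mul_natCast hη 14).and
    (eventually_le_const_mul_natCast (pow_pos hη 2) 4312)))))
  refine ⟨max M₁ (max n₀ N₀), fun m₀ hm₀ M n' κ K hM hn hκ hK => ?_⟩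
  -- `M ≥ m₀` lies beyond every threshold
  have hMm : m₀ ≤ M := by
    rw [hM]
    calc m₀ = m₀ * 1 * 1 := by ring
      _ ≤ m₀ * 2 * (D + 1) := by gcongr <;> omega
  have hM₁M : M₁ ≤ M := ((le_max_left _ _).trans hm₀).trans hMm
  have hn₀M : n₀ ≤ M := (((le_max_left _ _).trans (le_max_right _ _)).trans hm₀).trans hMm
  have hN₀M : N₀ ≤ M := (((le_max_right _ _).trans (le_max_right _ _)).trans hm₀).trans hMm
  obtain ⟨hT1, hT2, hT3, hT4, hT5⟩ := hM₁ M hM₁M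
  have hM1 : 1 ≤ M := by omega
  have hMr0 : (0 : ℝ) < M := by exact_mod_cast (show 0 < M by omega)
  have hMr1 : (1 : ℝ) ≤ M := by exact_mod_cast hM1
  have hMr24 : (24 : ℝ) ≤ M := by exact_mod_cast hT1
  have hMM2 : (M : ℝ) ≤ (M : ℝ) ^ 2 := by nlinarith
  -- `n' = 2 M^k ≥ M ≥ 1`
  have hnr : (n' : ℝ) = 2 * (M : ℝ) ^ k := by rw [hn]; push_cast; ring
  have hMk : M ≤ M ^ k := Nat.le_self_pow hk0 M
  have hMn : M ≤ n' := by rw [hn]; exact hMk.trans (Nat.le_mul_of_pos_left _ (by norm_num))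
  have hn1 : (1 : ℝ) ≤ n' := by exact_mod_cast hM1.trans hMn
  have hn0 : (0 : ℝ) ≤ n' := Nat.cast_nonneg _
  -- `n'^{θ₀} ≥ M^{kθ₀} ≥ M²`
  have hM2b : (M : ℝ) ^ 2 ≤ (n' : ℝ) ^ θ₀ := by
    calc (M : ℝ) ^ 2 = (M : ℝ) ^ ((2 : ℕ) : ℝ) := (Real.rpow_natCast _ 2).symm
      _ ≤ (M : ℝ) ^ ((k : ℝ) * θ₀) :=
          Real.rpow_le_rpow_of_exponent_le hMr1 (by push_cast; linarith)
      _ = ((M : ℝ) ^ k) ^ θ₀ := by rw [Real.rpow_mul hMr0.le, Real.rpow_natCast]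
      _ ≤ (n' : ℝ) ^ θ₀ :=
          Real.rpow_le_rpow (by positivity) (by rw [hnr]; linarith [pow_nonneg hMr0.le k]) hθ₀.le
  -- `κ` against `log (4M)/L`: `log (4M)/L ≤ κ ≤ log (4M)/L + 1 ≤ M/2`
  have hlog4M : Real.log (4 * M) = Real.log 4 + Real.log M :=
    Real.log_mul (by norm_num) hMr0.ne'
  have hq0 : 0 ≤ Real.log (4 * M) / L := by
    rw [hlog4M]
    exact div_nonneg (add_nonneg (Real.log_nonneg (by norm_num)) (Real.log_nonneg hMr1)) hL.le
  have hκle : (κ : ℝ) ≤ Real.log (4 * M) / L + 1 := by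
    rw [hκ]; exact (Nat.ceil_lt_add_one hq0).le
  have hκge : Real.log (4 * M) / L ≤ κ := by rw [hκ]; exact Nat.le_ceil _
  have hqM : Real.log (4 * M) / L + 1 ≤ M / 2 := by
    rw [div_add_one hL.ne', div_le_iff₀ hL, hlog4M]
    linarith
  have hκM2 : (κ : ℝ) ≤ M / 2 := hκle.trans hqM
  have hκM : (κ : ℝ) ≤ M := by linarith
  have hκMn : κ ≤ M := by exact_mod_cast hκM
  -- (1)–(3) `N₀ ≤ M`, `n₀ ≤ M ≤ n'`, `κ ≤ M ≤ M^k`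
  have hC1 : N₀ ≤ M := hN₀M
  have hC2 : n₀ ≤ n' := hn₀M.trans hMn
  have hC3 : κ ≤ M ^ k := hκMn.trans hMk
  -- (4) `2κ ≤ M ≤ M² ≤ n'^{θ₀}`
  have hC4 : (2 * κ : ℝ) ≤ (n' : ℝ) ^ θ₀ := by linarith
  -- (5) `(F₀^κ + F₁^κ)^M ≤ 2 (F₀^κ - F₁^κ)^M`
  have hC5 : (F0 ^ κ + F1 ^ κ) ^ M ≤ 2 * (F0 ^ κ - F1 ^ κ) ^ M := by
    have hκL : Real.log (4 * M) ≤ Real.log ((F0 / F1) ^ κ) := by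
      rw [Real.log_pow]; exact (div_le_iff₀ hL).1 hκge
    have h4M : 4 * (M : ℝ) ≤ (F0 / F1) ^ κ :=
      (Real.log_le_log_iff (by positivity) (by positivity)).1 hκL
    have ha : 0 < F0 ^ κ := pow_pos hF0 κ
    have hb : 0 < F1 ^ κ := pow_pos hF1 κ
    rw [div_pow, le_div_iff₀ hb] at h4M
    set r : ℝ := F1 ^ κ / F0 ^ κ with hr
    have hr0 : 0 ≤ r := by positivity
    have hrM : (M : ℝ) * r ≤ 1 / 4 := by
      rw [hr, ← mul_div_assoc, div_le_iff₀ ha]; linarith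
    have hr1 : r ≤ 1 := by nlinarith
    have hsum : F0 ^ κ + F1 ^ κ = F0 ^ κ * (1 + r) := by rw [hr]; field_simp
    have hdiff : F0 ^ κ - F1 ^ κ = F0 ^ κ * (1 - r) := by rw [hr]; field_simp
    have hA := acParam_one_add_pow_le_of_mul_le hr0 hrM (by norm_num)
    have hB := one_sub_mul_le_one_sub_pow hr1 M
    have hkey : (1 + r) ^ M ≤ 2 * (1 - r) ^ M := by
      norm_num at hA
      linarith
    rw [hsum, hdiff, mul_pow, mul_pow]
    have := mul_le_mul_of_nonneg_left hkey (pow_nonneg ha.le M)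
    linarith
  -- (7) `ε = n'^{-θ₀} ≤ 1`
  have hε0 : 0 ≤ (n' : ℝ) ^ (-θ₀) := Real.rpow_nonneg hn0 _
  have hC7 : (n' : ℝ) ^ (-θ₀) ≤ 1 := Real.rpow_le_one_of_one_le_of_nonpos hn1 (by linarith)
  -- (6) `2 (1+ε)^{3M} ≤ 16/7 < 21/8 ≤ 3 (1-ε)^{3M}` as `3Mε ≤ 3/M ≤ 1/8`
  have hC6 : 2 * (1 + (n' : ℝ) ^ (-θ₀)) ^ (3 * M) ≤ 3 * (1 - (n' : ℝ) ^ (-θ₀)) ^ (3 * M) := by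
    set ε : ℝ := (n' : ℝ) ^ (-θ₀) with hεdef
    have hεle : ε ≤ 1 / (M : ℝ) ^ 2 := by
      rw [hεdef, Real.rpow_neg hn0, ← one_div]
      exact one_div_le_one_div_of_le (by positivity) hM2b
    have h3Mε : ((3 * M : ℕ) : ℝ) * ε ≤ 1 / 8 := by
      push_cast
      calc (3 : ℝ) * M * ε ≤ 3 * M * (1 / (M : ℝ) ^ 2) := by gcongr
        _ = 3 / M := by field_simp
        _ ≤ 1 / 8 := by rw [div_le_iff₀ hMr0]; linarith
    have hA := acParam_one_add_pow_le_of_mul_le hε0 h3Mε (by norm_num)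
    have hB := one_sub_mul_le_one_sub_pow hC7 (3 * M)
    norm_num at hA
    linarith
  -- (8)–(10) `6K ≤ 6ηM/7 < ηM`, `2 ≤ M`, `1 ≤ K`
  have hK0 : (0 : ℝ) ≤ η * M / 7 := by positivity
  have hKle : (K : ℝ) ≤ η * M / 7 := by rw [hK]; exact Nat.floor_le hK0
  have hKgt : η * M / 7 - 1 < K := by rw [hK]; linarith [Nat.lt_floor_add_one (η * M / 7)]
  have hC8 : (2 * 3 * K : ℝ) < η * M := by linarith [mul_pos hη hMr0]
  have hC9 : 2 ≤ M := by omega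
  have hC10 : 1 ≤ K := by rw [hK]; exact Nat.le_floor (by push_cast; linarith)
  -- (11) `(6Mn' + 10Mκ)^{θ'} ≤ ((K²)^{k+1})^{θ'} = K`
  have hC11 : (((6 * M * n' + 10 * M * κ : ℕ) : ℝ)) ^ (1 / (2 * ((k : ℝ) + 1))) ≤ K := by
    have hK14 : η * M / 14 ≤ K := by linarith
    have hK2 : 22 * (M : ℝ) ≤ (K : ℝ) ^ 2 := by
      have h1 : (η * M / 14) ^ 2 ≤ (K : ℝ) ^ 2 := pow_le_pow_left₀ (by positivity) hK14 2
      linarith [mul_nonneg hMr0.le (sub_nonneg.2 hT5)]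
    have hκr : (κ : ℝ) ≤ (M : ℝ) ^ k := by exact_mod_cast hC3
    have hN : ((6 * M * n' + 10 * M * κ : ℕ) : ℝ) ≤ (K : ℝ) ^ (2 * (k + 1)) := by
      push_cast
      calc (6 * M * n' + 10 * M * κ : ℝ) = 6 * M * (2 * (M : ℝ) ^ k) + 10 * M * κ := by rw [hnr]
        _ ≤ 6 * M * (2 * (M : ℝ) ^ k) + 10 * M * (M : ℝ) ^ k := by gcongr
        _ = 22 * M * (M : ℝ) ^ k := by ring
        _ ≤ 22 * M * (22 * (M : ℝ)) ^ k := by gcongr; linarith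
        _ = (22 * (M : ℝ)) ^ (k + 1) := by ring
        _ ≤ ((K : ℝ) ^ 2) ^ (k + 1) := by gcongr
        _ = (K : ℝ) ^ (2 * (k + 1)) := by rw [← pow_mul]
    have h2k : ((2 * (k + 1) : ℕ) : ℝ) * (1 / (2 * ((k : ℝ) + 1))) = 1 := by
      push_cast; exact mul_one_div_cancel (by positivity)
    calc (((6 * M * n' + 10 * M * κ : ℕ) : ℝ)) ^ (1 / (2 * ((k : ℝ) + 1)))
        ≤ ((K : ℝ) ^ (2 * (k + 1))) ^ (1 / (2 * ((k : ℝ) + 1))) :=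
          Real.rpow_le_rpow (Nat.cast_nonneg _) hN (by positivity)
      _ = K := by
          rw [← Real.rpow_natCast, ← Real.rpow_mul (Nat.cast_nonneg K), h2k, Real.rpow_one]
  exact ⟨hC1, hC2, hC3, hC4, hC5, hC6, hC7, hC8, hC9, hC10, hC11⟩

end Summit.PneNP.PneNP.Cruxes.PolyDepthTwinsAbove.AnnealedCoverTwins
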